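import Summits.BirchSwinnertonDyer.BirchSwinnertonDyer.Theorems.PrintX11aUpperNonSurjThreeMuAnHardThreeOfMazur
import Summits.BirchSwinnertonDyer.BirchSwinnertonDyer.Theorems.ErratumRoadFiveNonSurjCornerBranchesAn
import Summits.BirchSwinnertonDyer.BirchSwinnertonDyer.Theorems.ErratumRoadFiveNonSurjCornerTwinKatoEngine
import HarnessLib

/-!
# Route `PrintX11a`, crux U3 `UpperNonSurjThree` (item stmt-BirchSwinnertonDyer-20613): the BODY of the crux from the
# displayed named facts alone (turnkey for the lead's composition `UpperNonSurjThree_of_muRoad` of line finemu3)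

Cell `bsd-print-x11a`, width seat bsd-line-x11a-p2 g2 (`--supports stmt-BirchSwinnertonDyer-20613 --as helper`). Theorems only;
Theses-free; BSD is not proved by any of this; nothing is asserted about any curve.

`ClassX11a.upperNonSurjThree_body_of_facts`: the thirteen named facts that the skeleton of record (`Lines/finemu3.lean` r1)
unpacks from `stub_pubFactsAn` (= K2's item 19949) — Stein–Wuthrich 6.1 ×2, GZK rank, modularity (entire `L`,
parametrisation), Greenberg–Stevens, Kato (12.2.1)/12.4/§17.13 ×3, Greenberg 1.5, Wuthrich Cor. 18, Kato fine inputs — PLUS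
Mazur 1978 Cor. 4.1 (`mazur_not_dvd_maninConstant_of_odd`, conjunct 9 of the same item) IMPLY the body of U3:
`ClassX11a W p → ¬Surj W p → p = 3 → Typed.MissingUpperBoundAt W p`.  The μ-certificate input of K2's μ-transfer
`multDivisibilityAt_of_katoFacts_of_muAn` is supplied by this seat's THEOREM `MultThreeMuAn.x11aNonSurjMuAnHardThree_of_mazur`
(Greenberg's analytic `μ = 0` at multiplicative `3`, from the Atkin–Lehner-extended orbit trick), on the WHOLE domain — no hard
locus, no (A), no certificate.  With it the lead's `UpperNonSurjThree_of_muRoad` becomes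
`obtain ⟨…⟩ := stub_pubFactsAn; exact upperNonSurjThree_body_of_facts …` and U3 closes modulo `stub_pubFactsAn` alone.
References: [Kato2004Asterisque] §17.13; [SteinWuthrich2013] Thm. 6.1; [Mazur1978] Cor. 4.1; [GreenbergLNM1716] Conj. 1.11.
-/

set_option linter.dupNamespace false
set_option autoImplicit false

noncomputable section

open scoped Classical MatrixGroups ModularForm

open CongruenceSubgroup WeierstrassCurve
  Literature.NumberTheory.EllipticCurves
  Literature.NumberTheory.EllipticCurves.ModularForms
  Literature.NumberTheory.EllipticCurves.Rank1Residual
  Literature.NumberTheory.EllipticCurves.Rank1Residual.Typed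
  Literature.NumberTheory.EllipticCurves.Wuthrich2014
  Literature.NumberTheory.EllipticCurves.SteinWuthrich2013
  Literature.NumberTheory.EllipticCurves.Greenberg1999
  Literature.NumberTheory.EllipticCurves.Kato2004
  Summit.BirchSwinnertonDyer.Rank1Residual
  Summit.BirchSwinnertonDyer.Rank1Residual.X11b
  Summit.BirchSwinnertonDyer.BirchSwinnertonDyer.Theorems

namespace Summit.BirchSwinnertonDyer.Rank1Residual.ClassX11a

/-- **The body of U3 from the displayed facts (μ-road, whole domain).** At every X11a pair `(W, 3)` with `ρ̄_{E,3}` not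
surjective: `ord₃ #Ш ≤ ord₃ #Ш_an` (`Typed.MissingUpperBoundAt W 3`), modulo the thirteen named facts of the route's fact
bundle and Mazur's Manin-constant fact — the analytic `μ = 0` input being the THEOREM
`MultThreeMuAn.x11aNonSurjMuAnHardThree_of_mazur`. [cite: Kato2004Asterisque, §17.13 (pp. 279–280)]
[cite: SteinWuthrich2013, Thm. 6.1 (p. 20)] [cite: Mazur1978, Cor. 4.1] [cite: GreenbergLNM1716, §1 Conj. 1.11 (p. 58)] -/
theorem upperNonSurjThree_body_of_facts
    (hJs : thm61_splitMultiplicative) (hJn : thm61_nonsplitMultiplicative)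
    (hGZK : rank_eq_analyticRank_of_analyticRank_le_one) (hmod : hasEntireLFunction_rat)
    (hpar : nonempty_modularParametrizationData)
    (hGS : ∀ (W : WeierstrassCurve ℚ) [W.IsElliptic] [W.IsGloballyMinimal] (p : ℕ) [Fact p.Prime],
      greenberg_stevens (W := W) (p := p))
    (hne : Kato2004.nonempty_iwasawaH1Data) (h12 : Kato2004.thm12_4)
    (hnsI : Kato2004.exists_multDivisibilityInputs_nonsplit) (hspI : Kato2004.exists_multDivisibilityInputs_split)
    (h15 : thm15_isTorsion_multiplicative_rat)
    (h18 : Wuthrich2014.corollary18_padicLFunction_mem_iwasawaAlgebra_multiplicative)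
    (hfine : Kato2004.exists_multDivisibilityInputs_fine)
    (hMz : mazur_not_dvd_maninConstant_of_odd) :
    ∀ (W : WeierstrassCurve ℚ) [W.IsElliptic] [W.IsGloballyMinimal] (p : ℕ) [Fact p.Prime],
      ClassX11a W p → ¬ Surj W p → p = 3 → Typed.MissingUpperBoundAt W p := by
  intro W _ _ p _ hX hns hp3
  subst hp3
  refine missingUpperBoundAt_of_classX11a_of_multDivisibilityAt hJs hJn hGZK hmod hpar W 3 (hGS W 3) hX ?_
  refine multDivisibilityAt_of_katoFacts_of_muAn hne h12 hnsI hspI h15 h18 hfine W 3 hX.2.1 hX.2.2.1 hX.2.2.2.1 hns ?_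
  intro N _ f hf ϖ hϖ a L hs hn hL
  have hμ := MultThreeMuAn.muAnZeroAt_three_of_mult_of_irr hMz W hX.2.2.1 hX.2.2.2.1 f hf ϖ hϖ
  by_cases hsplit : W.HasSplitMultiplicativeReductionAtPrime 3
  · rw [hs hsplit] at hL
    exact hμ.2 hsplit L ((isMultPAdicLFunctionOf_one_iff L).mp hL)
  · rw [hn hsplit] at hL
    exact hμ.1 hsplit L hL

end Summit.BirchSwinnertonDyer.Rank1Residual.ClassX11a

end
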